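import Summits.QuantumFields.YangMills.Theorems.BalabanLadderNTReferenceTransferTempered
import Summits.QuantumFields.YangMills.Theorems.BalabanLadderNTReferenceTorusTwoPoint
import Summits.QuantumFields.YangMills.Theorems.BalabanLadderNTBoundaryLawLargeDepth
import HarnessLib

/-!
# Seam `UVSeamRec` (stmt-QuantumFields-20043): TEMPERED two-point torus transfer — exterior oscillations only on a
# GOOD set of exteriors of the transfer cube, rarity of the bad set under Wilson's measure on each torus

Helper file (`--supports stmt-QuantumFields-20043`; owner R78; lead ym-spine-20043-p1 g7 09:44Z located
suggestion) of the fleet lead prover of crux `NT` (unit `ym-spine-19353-p1`, g5); route-independent.  CLAUSE SERVED: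
conjunct 2 of the registered v4-F `stub_floorsEngine` (two-point floor) in TEMPERED currency — the tempered twins of
g4's `Reference.abs_torusCov_sub_torusE_kerCov_le` / `abs_torusCov_sub_torusCov_le` / `pair_transfer_torus`:
the one-point / covariance oscillation ceilings of the transfer cube `P` are assumed only for exteriors in a measurable
set `Good ⊆ LGConfig` and the complement is paid by its mass `δ` under Wilson's measure of each torus (read through the
periodic lift), via the generic tempered law of total covariance (`…NTReferenceTransferTempered.lean`).

* `abs_kerCov_le` — `|kerCov^ζ(F, G')| ≤ 2 M_F M_G` (bookkeeping; measurability of `lift⁻¹ Good` is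
  `(continuous_torusLift _).measurable`);
* `abs_torusCov_sub_torusE_kerCov_le_on` — `|torusCov_L(F,G') − torusE_L(kerCov^ζ_P(F,G'))| ≤ (h+2M_Fδ)(h'+2M_Gδ) + 4M_FM_Gδ`;
* `abs_torusCov_sub_torusCov_le_on` — two tori: `≤ 2[(h+2M_Fδ)(h'+2M_Gδ) + 4M_FM_Gδ] + ω + 8M_FM_Gδ` (`δ` bounding both
  bad masses);
* `pair_transfer_torus_tempered` — per pair of action densities at coupling `β`: E1/E2-osc ON `Good` for the transfer cube
  only (`k = C₁(α/κ)⁴`, `w = C₂(α/κ)⁴/(1+‖y−x‖)⁴`) + rarity `δ` ⇒ the registered per-pair margin with `δ`-corrections.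

All at `δ = 0`, `Good = univ` reduce to g4's statements.  The `∀ L` floor statement with these hypotheses
(tempered `q2_floor_of_torusReference`) and the third-cumulant twin are the successor's (HANDOFF).

Refs: lead line fleet INBOX 2026-08-27T09:44:53Z; seam-s2 `CEILINGS-KERNEL-ANALYSIS-seam-s2.md` §4; g4
`…NTReferenceTransfer.lean`, `…NTReferenceTorusTwoPoint.lean`.
-/

set_option autoImplicit false

noncomputable section

open scoped SchwartzMap
open MeasureTheory Filter Topology
open Literature.MathematicalPhysics.QuantumFieldTheory Literature.MathematicalPhysics.QuantumLattice
open Literature.Probability.LatticeModels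
open Summit.QuantumFields.YangMills.Cruxes.OSLegsFromFemtoAndGap.DlrCollarTransfer
open Summit.QuantumFields.YangMills.Cruxes.OSLegsFromFemtoAndGap.DlrCollarTransfer.StubLower
  (isCylinder_mul isCylinder_dens)
open Summit.QuantumFields.YangMills.Cruxes.OSLegsAtWeakCouplingC.InheritedAmplitudeGates.StubInherit
  (integral_lift_eq_integral_kerE_cube)
open Summit.QuantumFields.YangMills.Cruxes.NT.BoundaryLaw (abs_kerE_le)

namespace Summit.QuantumFields.YangMills.Cruxes.NT.Reference

section Torus

variable (G : Type) [Group G] [TopologicalSpace G] [IsTopologicalGroup G] [CompactSpace G]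
  [MeasurableSpace G] [BorelSpace G] (r : LatticeRep G)

/-- The cube-kernel covariance of observables bounded by `M_F, M_G` is bounded by `2 M_F M_G`. [folklore] -/
theorem abs_kerCov_le (β : ℝ) (c : Fin 4 → ℤ) (b : ℕ) (ζ : LGConfig 4 G) {F G' : LGConfig 4 G → ℝ} {MF MG : ℝ}
    (hMF : ∀ U, |F U| ≤ MF) (hMG : ∀ U, |G' U| ≤ MG) : |kerCov G r β c b ζ F G'| ≤ 2 * MF * MG := by
  have h1 : |kerE G r β c b ζ (fun U => F U * G' U)| ≤ MF * MG :=
    abs_kerE_le G r β c b ζ (abs_mul_le_of_abs_le G hMF hMG)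
  have h2 : |kerE G r β c b ζ F| ≤ MF := abs_kerE_le G r β c b ζ hMF
  have h3 : |kerE G r β c b ζ G'| ≤ MG := abs_kerE_le G r β c b ζ hMG
  have hMF0 : 0 ≤ MF := (abs_nonneg _).trans h2
  unfold kerCov
  calc |kerE G r β c b ζ (fun U => F U * G' U) - kerE G r β c b ζ F * kerE G r β c b ζ G'|
      ≤ |kerE G r β c b ζ (fun U => F U * G' U)| + |kerE G r β c b ζ F * kerE G r β c b ζ G'| := abs_sub _ _
    _ ≤ MF * MG + MF * MG := by
        rw [abs_mul]
        exact add_le_add h1 (mul_le_mul h2 h3 (abs_nonneg _) hMF0)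
    _ = 2 * MF * MG := by ring

/-- **TEMPERED torus ↔ mean of cube-kernel covariances.**  A cube `P = (c₀, b₀)` in a torus of side `2L+1 ≥ b₀+3`,
bounded continuous cylinder observables `F, G'` windowed in `P`, a measurable set `Good` of exteriors on which the
`P`-kernel means of `F, G'` oscillate by at most `h, h'` (`h, h' ≥ 0`), whose complement has mass `≤ δ` under Wilson's
measure read through the lift.  Then
`|torusCov_L(F,G') − torusE_L(kerCov_P^ζ(F,G'))| ≤ (h + 2M_Fδ)(h' + 2M_Gδ) + 4M_FM_Gδ`. [folklore] -/
theorem abs_torusCov_sub_torusE_kerCov_le_on (β : ℝ) (c₀ : Fin 4 → ℤ) (b₀ L : ℕ) (hL : b₀ + 3 ≤ 2 * L + 1)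
    {F G' : LGConfig 4 G → ℝ} (hFc : Continuous F) (hGc : Continuous G') {MF MG : ℝ}
    (hMF : ∀ U, |F U| ≤ MF) (hMG : ∀ U, |G' U| ≤ MG)
    {SF SG : Finset (Literature.MathematicalPhysics.QuantumLattice.ZdEdge 4)}
    (hFS : IsCylinder F SF) (hGS : IsCylinder G' SG)
    (hSF : ∀ e ∈ SF, ∀ j, c₀ j ≤ e.1 j ∧ e.1 j ≤ c₀ j + b₀)
    (hSG : ∀ e ∈ SG, ∀ j, c₀ j ≤ e.1 j ∧ e.1 j ≤ c₀ j + b₀)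
    {Good : Set (LGConfig 4 G)} (hGood : MeasurableSet Good) {h h' δ : ℝ} (hh : 0 ≤ h) (hh' : 0 ≤ h')
    (hδ : (wilsonMeasure (d := 4) (L := 2 * L + 1) r.ρ β).real ((torusLift (2 * L + 1)) ⁻¹' Good)ᶜ ≤ δ)
    (hoF : ∀ ζ ∈ Good, ∀ ζ' ∈ Good, |kerE G r β c₀ b₀ ζ F - kerE G r β c₀ b₀ ζ' F| ≤ h)
    (hoG : ∀ ζ ∈ Good, ∀ ζ' ∈ Good, |kerE G r β c₀ b₀ ζ G' - kerE G r β c₀ b₀ ζ' G'| ≤ h') :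
    |(torusE G r β L (fun U => F U * G' U) - torusE G r β L F * torusE G r β L G')
      - torusE G r β L (fun ζ => kerCov G r β c₀ b₀ ζ F G')| ≤
      (h + 2 * MF * δ) * (h' + 2 * MG * δ) + 4 * MF * MG * δ := by
  classical
  haveI := r.secondCountableTopology
  haveI := isProbabilityMeasure_wilsonMeasure (d := 4) (L := 2 * L + 1) r.ρ r.continuous β
  have hFG : Continuous fun U => F U * G' U := hFc.mul hGc
  have hFGb : ∀ U, |F U * G' U| ≤ MF * MG := abs_mul_le_of_abs_le G hMF hMG
  have e1 := integral_lift_eq_integral_kerE_cube G r β c₀ b₀ (2 * L + 1) hL hFc hMF hFS hSF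
  have e2 := integral_lift_eq_integral_kerE_cube G r β c₀ b₀ (2 * L + 1) hL hGc hMG hGS hSG
  have e3 := integral_lift_eq_integral_kerE_cube G r β c₀ b₀ (2 * L + 1) hL hFG hFGb (isCylinder_mul hFS hGS)
    (fun e he j => by
      rcases Finset.mem_union.1 he with h₁ | h₂
      · exact hSF e h₁ j
      · exact hSG e h₂ j)
  have key := abs_cov_sub_integral_condCov_le_of_osc_on (μ := wilsonMeasure (d := 4) (L := 2 * L + 1) r.ρ β)
    (continuous_kerE_torusLift G r β c₀ b₀ (2 * L + 1) hFc hMF)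
    (continuous_kerE_torusLift G r β c₀ b₀ (2 * L + 1) hGc hMG)
    (continuous_kerE_torusLift G r β c₀ b₀ (2 * L + 1) hFG hFGb)
    ((continuous_torusLift (d := 4) (G := G) (2 * L + 1)).measurable hGood) hh hh'
    (fun U => abs_kerE_le G r β c₀ b₀ _ hMF) (fun U => abs_kerE_le G r β c₀ b₀ _ hMG)
    (fun U hU V hV => hoF _ hU _ hV) (fun U hU V hV => hoG _ hU _ hV) hδ
  simp only [torusE]
  rw [e1, e2, e3]
  simp only [kerCov] at key ⊢
  exact key

/-- **TEMPERED two tori compared.**  Same data on two tori of sides `2L+1, 2L'+1 ≥ b₀+3`, both bad masses `≤ δ`, and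
the `P`-kernel covariance oscillating by `≤ ω` on `Good` (`ω ≥ 0`):
`|torusCov_L(F,G') − torusCov_{L'}(F,G')| ≤ 2[(h+2M_Fδ)(h'+2M_Gδ) + 4M_FM_Gδ] + (ω + 2(2M_FM_G)(δ+δ))`. [folklore] -/
theorem abs_torusCov_sub_torusCov_le_on (β : ℝ) (c₀ : Fin 4 → ℤ) (b₀ L L' : ℕ) (hL : b₀ + 3 ≤ 2 * L + 1)
    (hL' : b₀ + 3 ≤ 2 * L' + 1)
    {F G' : LGConfig 4 G → ℝ} (hFc : Continuous F) (hGc : Continuous G') {MF MG : ℝ}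
    (hMF : ∀ U, |F U| ≤ MF) (hMG : ∀ U, |G' U| ≤ MG)
    {SF SG : Finset (Literature.MathematicalPhysics.QuantumLattice.ZdEdge 4)}
    (hFS : IsCylinder F SF) (hGS : IsCylinder G' SG)
    (hSF : ∀ e ∈ SF, ∀ j, c₀ j ≤ e.1 j ∧ e.1 j ≤ c₀ j + b₀)
    (hSG : ∀ e ∈ SG, ∀ j, c₀ j ≤ e.1 j ∧ e.1 j ≤ c₀ j + b₀)
    {Good : Set (LGConfig 4 G)} (hGood : MeasurableSet Good) {h h' ω δ : ℝ} (hh : 0 ≤ h) (hh' : 0 ≤ h')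
    (hω : 0 ≤ ω)
    (hδ : (wilsonMeasure (d := 4) (L := 2 * L + 1) r.ρ β).real ((torusLift (2 * L + 1)) ⁻¹' Good)ᶜ ≤ δ)
    (hδ' : (wilsonMeasure (d := 4) (L := 2 * L' + 1) r.ρ β).real ((torusLift (2 * L' + 1)) ⁻¹' Good)ᶜ ≤ δ)
    (hoF : ∀ ζ ∈ Good, ∀ ζ' ∈ Good, |kerE G r β c₀ b₀ ζ F - kerE G r β c₀ b₀ ζ' F| ≤ h)
    (hoG : ∀ ζ ∈ Good, ∀ ζ' ∈ Good, |kerE G r β c₀ b₀ ζ G' - kerE G r β c₀ b₀ ζ' G'| ≤ h')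
    (hoC : ∀ ζ ∈ Good, ∀ ζ' ∈ Good, |kerCov G r β c₀ b₀ ζ F G' - kerCov G r β c₀ b₀ ζ' F G'| ≤ ω) :
    |(torusE G r β L (fun U => F U * G' U) - torusE G r β L F * torusE G r β L G')
      - (torusE G r β L' (fun U => F U * G' U) - torusE G r β L' F * torusE G r β L' G')| ≤
      2 * ((h + 2 * MF * δ) * (h' + 2 * MG * δ) + 4 * MF * MG * δ) + (ω + 2 * (2 * MF * MG) * (δ + δ)) := by
  haveI := r.secondCountableTopology
  haveI := isProbabilityMeasure_wilsonMeasure (d := 4) (L := 2 * L + 1) r.ρ r.continuous β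
  haveI := isProbabilityMeasure_wilsonMeasure (d := 4) (L := 2 * L' + 1) r.ρ r.continuous β
  have t1 := abs_torusCov_sub_torusE_kerCov_le_on G r β c₀ b₀ L hL hFc hGc hMF hMG hFS hGS hSF hSG hGood hh hh' hδ
    hoF hoG
  have t2 := abs_torusCov_sub_torusE_kerCov_le_on G r β c₀ b₀ L' hL' hFc hGc hMF hMG hFS hGS hSF hSG hGood hh hh'
    hδ' hoF hoG
  have hcont := continuous_kerCov G r β c₀ b₀ hFc hGc hMF hMG
  have t3 : |torusE G r β L (fun ζ => kerCov G r β c₀ b₀ ζ F G') -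
      torusE G r β L' (fun ζ => kerCov G r β c₀ b₀ ζ F G')| ≤ ω + 2 * (2 * MF * MG) * (δ + δ) := by
    unfold torusE
    exact abs_integral_sub_integral_le_of_osc_on (hcont.comp (continuous_torusLift _))
      (hcont.comp (continuous_torusLift _)) ((continuous_torusLift (d := 4) (G := G) (2 * L + 1)).measurable hGood)
      ((continuous_torusLift (d := 4) (G := G) (2 * L' + 1)).measurable hGood) hω
      (fun U => abs_kerCov_le G r β c₀ b₀ _ hMF hMG) (fun V => abs_kerCov_le G r β c₀ b₀ _ hMF hMG)
      (fun U hU V hV => hoC _ hU _ hV) hδ hδ'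
  have tri := abs_sub_le
    (torusE G r β L (fun U => F U * G' U) - torusE G r β L F * torusE G r β L G')
    (torusE G r β L (fun ζ => kerCov G r β c₀ b₀ ζ F G'))
    (torusE G r β L' (fun U => F U * G' U) - torusE G r β L' F * torusE G r β L' G')
  have tri₂ := abs_sub_le (torusE G r β L (fun ζ => kerCov G r β c₀ b₀ ζ F G'))
    (torusE G r β L' (fun ζ => kerCov G r β c₀ b₀ ζ F G'))
    (torusE G r β L' (fun U => F U * G' U) - torusE G r β L' F * torusE G r β L' G')
  rw [abs_sub_comm] at t2
  linarith

/-- **TEMPERED per-pair transfer for two action densities.**  Transfer cube `P` of radius `RP` in two tori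
`2L+1, 2L'+1 ⊇ P`; sites `x, y` of depth `≥ κ/α` (`≥ 1`) in `P`; densities bounded by `M`; a measurable set `Good`
of exteriors of `P` with bad mass `≤ δ` on both tori; ON `Good`: one-point oscillations `≤ C₁/depth⁴` and covariance
oscillation `≤ C₂/min depth⁴/(1+‖y−x‖)⁴` (E1/E2-osc for the transfer cube, tempered).  Then, with `k = C₁(α/κ)⁴`,
`w = C₂(α/κ)⁴/(1+‖y−x‖)⁴`:
`|torusCov_L(dens x, dens y) − torusCov_{L'}(dens x, dens y)| ≤ 2[(k+2Mδ)² + 4M²δ] + (w + 2(2M²)(δ+δ))`. [folklore] -/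
theorem pair_transfer_torus_tempered (β : ℝ) {C₁ C₂ κ α M : ℝ} (hC₁ : 0 ≤ C₁) (hC₂ : 0 ≤ C₂) (hκ : 0 < κ)
    (hα : 0 < α) (hM : ∀ (x : Fin 4 → ℤ) (U : LGConfig 4 G), |dens G r x U| ≤ M) {RP L L' : ℕ}
    (hL : 2 * RP + 1 + 3 ≤ 2 * L + 1) (hL' : 2 * RP + 1 + 3 ≤ 2 * L' + 1)
    {Good : Set (LGConfig 4 G)} (hGood : MeasurableSet Good) {δ : ℝ}
    (hδ : (wilsonMeasure (d := 4) (L := 2 * L + 1) r.ρ β).real ((torusLift (2 * L + 1)) ⁻¹' Good)ᶜ ≤ δ)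
    (hδ' : (wilsonMeasure (d := 4) (L := 2 * L' + 1) r.ρ β).real ((torusLift (2 * L' + 1)) ⁻¹' Good)ᶜ ≤ δ)
    (H1 : ∀ ζ ∈ Good, ∀ ζ' ∈ Good, ∀ x : Fin 4 → ℤ, 1 ≤ depth (fun _ => -(RP : ℤ)) (2 * RP + 1) x →
      |kerE G r β (fun _ => -(RP : ℤ)) (2 * RP + 1) ζ (dens G r x) -
        kerE G r β (fun _ => -(RP : ℤ)) (2 * RP + 1) ζ' (dens G r x)| ≤
        C₁ / (depth (fun _ => -(RP : ℤ)) (2 * RP + 1) x : ℝ) ^ 4)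
    (H2 : ∀ ζ ∈ Good, ∀ ζ' ∈ Good, ∀ x y : Fin 4 → ℤ, 1 ≤ depth (fun _ => -(RP : ℤ)) (2 * RP + 1) x →
      1 ≤ depth (fun _ => -(RP : ℤ)) (2 * RP + 1) y →
      |kerCov G r β (fun _ => -(RP : ℤ)) (2 * RP + 1) ζ (dens G r x) (dens G r y) -
        kerCov G r β (fun _ => -(RP : ℤ)) (2 * RP + 1) ζ' (dens G r x) (dens G r y)| ≤
        C₂ / ((min (depth (fun _ => -(RP : ℤ)) (2 * RP + 1) x) (depth (fun _ => -(RP : ℤ)) (2 * RP + 1) y) : ℕ) : ℝ) ^ 4 /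
          (1 + ‖siteToE (y - x)‖) ^ 4)
    {x y : Fin 4 → ℤ}
    (hx : κ / α ≤ (depth (fun _ => -(RP : ℤ)) (2 * RP + 1) x : ℝ) ∧ 1 ≤ depth (fun _ => -(RP : ℤ)) (2 * RP + 1) x)
    (hy : κ / α ≤ (depth (fun _ => -(RP : ℤ)) (2 * RP + 1) y : ℝ) ∧ 1 ≤ depth (fun _ => -(RP : ℤ)) (2 * RP + 1) y) :
    |(torusE G r β L (fun U => dens G r x U * dens G r y U) - torusE G r β L (dens G r x) * torusE G r β L (dens G r y))
      - (torusE G r β L' (fun U => dens G r x U * dens G r y U) -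
          torusE G r β L' (dens G r x) * torusE G r β L' (dens G r y))| ≤
      2 * ((C₁ * (α / κ) ^ 4 + 2 * M * δ) * (C₁ * (α / κ) ^ 4 + 2 * M * δ) + 4 * M * M * δ) +
        (C₂ * (α / κ) ^ 4 / (1 + ‖siteToE (y - x)‖) ^ 4 + 2 * (2 * M * M) * (δ + δ)) := by
  obtain ⟨hxκ, hx1⟩ := hx
  obtain ⟨hyκ, hy1⟩ := hy
  have hk0 : 0 ≤ C₁ * (α / κ) ^ 4 := by positivity
  have hpos : 0 < (1 + ‖siteToE (y - x)‖) ^ 4 := by positivity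
  have hw0 : 0 ≤ C₂ * (α / κ) ^ 4 / (1 + ‖siteToE (y - x)‖) ^ 4 := by positivity
  have ho : ∀ {u : Fin 4 → ℤ}, κ / α ≤ (depth (fun _ => -(RP : ℤ)) (2 * RP + 1) u : ℝ) →
      1 ≤ depth (fun _ => -(RP : ℤ)) (2 * RP + 1) u →
      ∀ ζ ∈ Good, ∀ ζ' ∈ Good, |kerE G r β (fun _ => -(RP : ℤ)) (2 * RP + 1) ζ (dens G r u) -
        kerE G r β (fun _ => -(RP : ℤ)) (2 * RP + 1) ζ' (dens G r u)| ≤ C₁ * (α / κ) ^ 4 :=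
    fun huκ hu1 ζ hζ ζ' hζ' => (H1 ζ hζ ζ' hζ' _ hu1).trans (div_pow_depth_le hC₁ hκ hα huκ)
  have hmin : κ / α ≤ ((min (depth (fun _ => -(RP : ℤ)) (2 * RP + 1) x)
      (depth (fun _ => -(RP : ℤ)) (2 * RP + 1) y) : ℕ) : ℝ) := by
    rw [Nat.cast_min]; exact le_min hxκ hyκ
  have hw : ∀ ζ ∈ Good, ∀ ζ' ∈ Good, |kerCov G r β (fun _ => -(RP : ℤ)) (2 * RP + 1) ζ (dens G r x) (dens G r y) -
      kerCov G r β (fun _ => -(RP : ℤ)) (2 * RP + 1) ζ' (dens G r x) (dens G r y)| ≤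
      C₂ * (α / κ) ^ 4 / (1 + ‖siteToE (y - x)‖) ^ 4 :=
    fun ζ hζ ζ' hζ' => (H2 ζ hζ ζ' hζ' x y hx1 hy1).trans
      (div_le_div_of_nonneg_right (div_pow_depth_le hC₂ hκ hα hmin) hpos.le)
  exact abs_torusCov_sub_torusCov_le_on G r β _ _ L L' hL hL' (continuous_dens r x) (continuous_dens r y) (hM x) (hM y)
    (isCylinder_dens G r x) (isCylinder_dens G r y) (dens_supp_window_of_depth_pos G r hx1)
    (dens_supp_window_of_depth_pos G r hy1) hGood hk0 hk0 hw0 hδ hδ' (ho hxκ hx1) (ho hyκ hy1) hw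

end Torus

end Summit.QuantumFields.YangMills.Cruxes.NT.Reference

end
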